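import Mathlib
import Summits.KontsevichZagierPeriods.Zeta5Search.RecordAtlasCells
import Summits.KontsevichZagierPeriods.Zeta5Search.RecordCellCzProof
import HarnessLib

/-!
# ζ(5) search — record cell N of gen-2 g9's atlas is a THEOREM (by name)

Cell `pub-zeta5` (HONEST FRAMING: systematic search; no irrationality claim unless certified), P1 prover seat generation 7.
`RecordAtlas.RecordCellN` (the zero cell `41n < 5p`, `2p ≤ 17n`, i.e. `θ ∈ (41/5, 17/2]`, bound `v_p(Cas₇(b(n))) ≥ −11`, THEOREM LB `−13`)
is, verbatim, P1 g6's `CellC.recordCellCz` (`RecordCellCzProof.lean`, p225261).  This file only records the discharge by name so that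
census can flip the cell to `proved`.  Valuations of rationals; nothing about irrationality.
-/

namespace Summit.KontsevichZagierPeriods.Zeta5Search.RecordAtlas

/-- **RECORD CELL N IS A THEOREM**: for `n ≥ 2` and every prime `p` with `41n < 5p`, `2p ≤ 17n`, `v_p(Cas₇(b(n))) ≥ −11`
(P1 g6's zero cell `CellC.recordCellCz`). -/
theorem recordCellN_holds : RecordCellN := CellC.recordCellCz

end Summit.KontsevichZagierPeriods.Zeta5Search.RecordAtlas
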